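import Summits.CriticalPhenomena.Ising3DConformalLimit.Theses.ArmDressing
import Summits.CriticalPhenomena.Ising3DConformalLimit.Theorems.ArmDressingArmDressingGlueDefs
import Summits.CriticalPhenomena.Ising3DConformalLimit.Theorems.ArmDressingArmDressingGlueWiredBoxLimit
import Summits.CriticalPhenomena.Ising3DConformalLimit.Theorems.ArmDressingArmDressingGlueArm1Pos
import Summits.CriticalPhenomena.Ising3DConformalLimit.Theorems.ArmDressingArmDressingGlueEdwardsSokal
import Summits.CriticalPhenomena.Ising3DConformalLimit.Theorems.ArmDressingArmDressingGlueDressedLimitExists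
import Summits.CriticalPhenomena.Ising3DConformalLimit.Theorems.ArmDressingArmDressingGlueInvSystems
import Summits.CriticalPhenomena.Ising3DConformalLimit.Theorems.ArmDressingArmDressingGlueOfCrossLawPositive
import Summits.CriticalPhenomena.Ising3DConformalLimit.Theorems.ArmDressingArmDressingGlueSecondMoment
import Summits.CriticalPhenomena.Ising3DConformalLimit.Theorems.ArmDressingArmDressingGlueAxisTwoPoint
import Summits.CriticalPhenomena.Ising3DConformalLimit.Theorems.ArmDressingArmDressingGlueArmDoubling
import Summits.CriticalPhenomena.Ising3DConformalLimit.Theorems.ArmDressingArmDressingGlueBoxTwoPointSums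
import Summits.CriticalPhenomena.Ising3DConformalLimit.Theorems.ArmDressingArmDressingGlueFkgReduction
import Summits.CriticalPhenomena.Ising3DConformalLimit.Theorems.ArmDressingArmDressingGlueTwoBallPositive
import Summits.CriticalPhenomena.Ising3DConformalLimit.Theorems.ArmDressingArmDressingGlue
import Summits.CriticalPhenomena.Ising3DConformalLimit.Theorems.MoebiusLimitExists.Negative.ScaleRedundant
import Literature.Probability.LatticeModels.CriticalUrsellFourSign
import Literature.Probability.LatticeModels.TwoPointSupNormMonotone
import Literature.Probability.LatticeModels.RandomClusterFKG
import HarnessLib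
import HarnessLib.Audit

/-!
# Skeleton for crux `ArmDressingGlue` — item stmt-CriticalPhenomena-15700, route `ArmDressing`, rank 9
# line `registered` (= `Cruxes/ArmDressingGlue/Lines/birth.lean`), RESHAPED v3 by the continuation lead
# prover-line-stmt-CriticalPhenomena-15700-c1-0 (2026-08-17)

THE CRUX (by name `ArmDressing.ArmDressingGlue`):
  `BallConnectivityMoebius → EvenPatternDecoupling → ArmExtensionFactorisation → OneArmRenormalisedLimit`.

STATE INHERITED (v2.3, previous lead): the crux is a THEOREM modulo ONE statement,
`InvBook.armDressingGlue_of_crossLawPositive : CrossLawPositive → ArmDressing.ArmDressingGlue`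
(Theorems/ArmDressingArmDressingGlueOfCrossLawPositive.lean, p156871), where `CrossLawPositive`
(Theorems/ArmDressingArmDressingGlueDefs.lean) says: for every family of `n + n` generalised balls with non-zero
radii, `liminf_{δ→0⁺} Pr[disc_δ gball_i ↔ disc_δ gball_{n+i} ∀ i < n] > 0`.  The previous lead registered it bare
(`stub_crossLawPositive : CrossLawPositive`) and ended `promote-stub`, arguing it is 3D-RSW and open.

RESHAPE v2.3 → v3 (this lead): `CrossLawPositive` IS derivable from cruxes B ∧ C (plus the landed support ES and
tree facts), by a SECOND-MOMENT METHOD IN ONE-ARM UNITS.  For two disjoint closed balls `A, B` and the pair count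
`N = #{(x,y) ∈ A^δ × B^δ : x ↔ y}` (Cauchy–Schwarz at finite `L`, then `L → ∞`):
  `Pr[A^δ ↔ B^δ] · Σ_{x,x',y,y'} Pr[x↔y ∧ x'↔y'] ≥ (Σ_{x,y} G(x,y))²`,   `G = ⟨σσ⟩_{β_c}` (ES, n = 2),
  `Pr[x↔y ∧ x'↔y'] ≤ Pr[EVEN(x,y,x',y')] = ⟨σ_xσ_yσ_{x'}σ_{y'}⟩_{β_c}` (ES, n = 4)
  `≤ G(x,y)G(x',y') + G(x,x')G(y,y') + G(x,y')G(y,x')` (Lebowitz, tree `criticalUrsellFour_nonpos`),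
so `Pr[A^δ ↔ B^δ] ≥ 1/(2 + χ_Aχ_B/(ΣG)²)`, `χ_A = Σ_{x,x'∈A^δ} G(x,x')`.  The a-priori window
`c‖x‖⁻² ≤ G ≤ C‖x‖⁻¹` cannot bound `χ_Aχ_B/(ΣG)²` (this is where v2.3 stopped), but B ∧ C ∧ ES can: the dressed
limit (landed `DressedLimitProof.stub_dressedLimitExists`) gives `G(k e₁) ≍ a(k)²` with `a(k) := arm1(1/k, 1)`
(`S₂(0,e₁) > 0`), and the one-arm ratio `a(κK)/a(K) → κ^{-Δ}`, `Δ ∈ [1/2,1]` (landed `InvBook.tendsto_arm1_ratio`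
with `MoebiusLimitExistsNegative.exists_scaleCovariant_normalised`) gives dyadic doubling `a(K/2) ≤ λ a(K)` with
`λ² < 8`; with the Messager–Miracle-Solé sup-norm comparison (tree `twoPointPlus_le_of_mul_supNorm_le`) every lattice
point is moved to the axis, whence `Σ_{‖y‖_∞ ≤ M} G(y) ≤ C' M³ a(M)²` and `G ≥ c' a(M)²` on the box `Λ_M`
(dyadic shells, geometric series since `8/λ² > 1`).  Counting `#A^δ ≍ δ⁻³` closes `χ_Aχ_B/(ΣG)² = O(1)`:
TWO-BALL POSITIVITY.  Finally FKG (tree `rcMeasure_fkg_holds`) and monotonicity of `Pr` in the probe sets reduce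
`CrossLawPositive` (n pairs of generalised balls, each containing a small closed ball, the two of a pair disjoint)
to two-ball positivity.  NO new hypothesis: the crux closes outright.

REGISTERED STUBS (v3; 6 ≤ stubs_max = 7; the only `sorry`s of the file):
* `stub_secondMoment`      — the displayed Cauchy–Schwarz/ES/Lebowitz inequality for finite disjoint `X, Y ⊂ ℤ³`.
* `stub_axisTwoPoint`      — B → C → `c a(k)² ≤ G(k e₁) ≤ C a(k)²` for `k ≥ k₀`.
* `stub_armDoubling`       — B → C → dyadic doubling of `a`, `a` antitone, `0 < a ≤ 1`.
* `stub_boxTwoPointSums`   — axis asymptotics + doubling ⇒ `Σ_{Λ_M} G ≤ C' M³ a(M)²` and `G ≥ c' a(M)²` on `Λ_M`.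
* `stub_twoBallPositive`   — second moment + doubling + box sums ⇒ two-ball positivity (LEAD's stub).
* `stub_fkgReduction`      — two-ball positivity ⇒ `CrossLawPositive` (sub-balls, monotonicity, FKG, `L → ∞`).
COMPOSITION `ArmDressingGlue_of` (real proof, no sorry of its own): thread B, C through the stubs and apply
`InvBook.armDressingGlue_of_crossLawPositive`.

STATUS (v3.2 FINAL, 2026-08-17): ALL SIX STUBS LANDED — `stub_secondMoment` (p159904,
Theorems/ArmDressingArmDressingGlueSecondMoment.lean), `stub_axisTwoPoint` (p160261, …AxisTwoPoint.lean),
`stub_armDoubling` (p160534, …ArmDoubling.lean), `stub_boxTwoPointSums` (p161029, …BoxTwoPointSums.lean),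
`stub_fkgReduction` (p160868, …FkgReduction.lean), `stub_twoBallPositive` (p161907, …TwoBallPositive.lean, lead).
NO SORRY.  The crux item stmt-CriticalPhenomena-15700 is CLOSED `proved` by
`Summit.CriticalPhenomena.Ising3DConformalLimit.Theorems.armDressing_armDressingGlue_proof : ArmDressing.ArmDressingGlue`
(Theorems/ArmDressingArmDressingGlue.lean, p162524, commit 1c79e1c68708).

References: Camia–Feng arXiv:2411.01467 §3.2 (planar template); Lebowitz 1974 (U₄ ≤ 0); Messager–Miracle-Solé
1977 / Aizenman–Duminil-Copin 2021 (5.3) (sup-norm comparison); Fortuin–Kasteleyn–Ginibre 1971 (FKG);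
Grimmett 2006 Thm 4.19 (thermodynamic limit).
-/

noncomputable section

namespace Summit.CriticalPhenomena.Ising3DConformalLimit.Cruxes.ArmDressingGlue.Birth

open scoped BigOperators Topology Classical MeasureTheory
open Filter Set MeasureTheory
open Literature.Probability.LatticeModels Literature.Probability.Percolation
open Summit.CriticalPhenomena.Ising3DConformalLimit.Theses
open Summit.CriticalPhenomena.Ising3DConformalLimit.Cruxes.ArmDressingGlue.Vocab

local notation "E3" => EuclideanSpace ℝ (Fin 3)

/-! ## The registered stubs (the only `sorry`s of the file)

Notation in comments: `a(K) := arm1 K⁻¹ 1` (one-arm probability of the origin to Euclidean lattice distance `K`),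
`G(x,y) := criticalCorr 3 2 ![x, y] = criticalTwoPoint 3 (y - x)` (`criticalCorr_two_pair`). -/

/-- **STUB S1 — second-moment inequality for two finite probe sets** (pair count `N`, Cauchy–Schwarz under the
wired box measure `μ L` for `L ≥ L₀`, then `L → ∞` by `InvBook.tendsto_PrL`; `{x↔y} ∩ {x'↔y'} ⊆ EVEN(x,y,x',y')`
because lattice connection is an equivalence relation; `Pr₄[EVEN] = ⟨σ_xσ_yσ_{x'}σ_{y'}⟩` and `Pr₂[x↔y] = ⟨σ_xσ_y⟩`
by the infinite-volume Edwards–Sokal identity (`EdwardsSokalProof.stub_edwardsSokalIdentity`, whose proof does not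
use injectivity); Lebowitz `criticalUrsellFour_nonpos` (coincidences allowed)).  Size M/L.
[cite: Lebowitz1974, Theorem, eq. (2.5b)] -/
theorem stub_secondMoment :
    ∀ (X Y : Finset (Site 3)), Disjoint X Y →
      (∑ x ∈ X, ∑ y ∈ Y, criticalCorr 3 2 ![x, y]) ^ 2 ≤
        Pr 2 ![(↑X : Set (Site 3)), ↑Y] {R | R 0 1} *
          ∑ x ∈ X, ∑ y ∈ Y, ∑ x' ∈ X, ∑ y' ∈ Y,
            (criticalCorr 3 2 ![x, y] * criticalCorr 3 2 ![x', y'] +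
              criticalCorr 3 2 ![x, x'] * criticalCorr 3 2 ![y, y'] +
              criticalCorr 3 2 ![x, y'] * criticalCorr 3 2 ![y, x']) :=
  CrossPos.stub_secondMoment  -- LANDED

/-- **STUB S2 — axis two-point asymptotics in one-arm units** (from B, C: ES := ⟨stub_wiredBoxLimit,
stub_arm1Pos _, stub_edwardsSokalIdentity⟩, dressed limit `S` of `DressedLimitProof.stub_dressedLimitExists`,
evaluated at `![0, e₁] ∈ NonCoincident` along `δ = 1/k`: `a(k)⁻² G(0, k e₁) → S₂(0,e₁) > 0`, so eventually in
`[S₂/2, 2S₂]`; `latticeApprox k⁻¹ e₁ = Pi.single 0 k`, `criticalCorr_two`).  Size M. [cite: CamiaFeng2025, Thm 1] -/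
theorem stub_axisTwoPoint :
    ArmDressing.EvenPatternDecoupling → ArmDressing.ArmExtensionFactorisation →
      ∃ (c C : ℝ) (k₀ : ℕ), 0 < c ∧ ∀ k : ℕ, k₀ ≤ k →
        c * arm1 (k : ℝ)⁻¹ 1 ^ 2 ≤ criticalTwoPoint 3 (Pi.single 0 (k : ℤ)) ∧
          criticalTwoPoint 3 (Pi.single 0 (k : ℤ)) ≤ C * arm1 (k : ℝ)⁻¹ 1 ^ 2 :=
  CrossPos.stub_axisTwoPoint  -- LANDED

/-- **STUB S3 — dyadic doubling, antitonicity and range of the one-arm probability** (from B, C: dressed limit,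
normalised, `Δ ∈ [1/2,1]` by `MoebiusLimitExistsNegative.exists_scaleCovariant_normalised`, then
`InvBook.tendsto_arm1_ratio` with `κ = 1/2` along `δ = K⁻¹`: `a(K/2)/a(K) → 2^Δ ≤ 2 < 5/2 =: λ`, `λ² < 8`;
antitone by `InvBook.Pr_mono_set` (the far set `disc K⁻¹ (ball 0 1)ᶜ = {‖x‖ ≥ K}` shrinks as `K` grows);
`0 < a(K)` for `K ≥ 1` is `Arm1Pos`, `a ≤ 1` is `InvBook.Pr_mem_Icc`).  Size M. [cite: CamiaFeng2025, Lemma 17] -/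
theorem stub_armDoubling :
    ArmDressing.EvenPatternDecoupling → ArmDressing.ArmExtensionFactorisation →
      (∃ lam K₀ : ℝ, 0 < lam ∧ lam ^ 2 < 8 ∧ 0 < K₀ ∧
          ∀ K : ℝ, K₀ ≤ K → arm1 (K / 2)⁻¹ 1 ≤ lam * arm1 K⁻¹ 1) ∧
        (∀ K K' : ℝ, 0 < K → K ≤ K' → arm1 K'⁻¹ 1 ≤ arm1 K⁻¹ 1) ∧
        (∀ K : ℝ, 1 ≤ K → 0 < arm1 K⁻¹ 1 ∧ arm1 K⁻¹ 1 ≤ 1) :=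
  CrossPos.stub_armDoubling  -- LANDED

/-- **STUB S7 — two-point sums over boxes in one-arm units** (pure lattice analysis: the Messager–Miracle-Solé
sup-norm comparison `twoPointPlus_le_of_mul_supNorm_le` (`criticalTwoPoint 3 = twoPointPlus 3 (criticalBeta 3)`)
moves `y` with `‖y‖_∞ = m` to the axis points `⌊m/3⌋ e₁` (upper) and `3M e₁` (lower); the axis asymptotics turn
these into `a(·)²`; the doubling chain `a(K/2^j) ≤ λ^j a(K)` compares scales; dyadic shells
`#{‖y‖_∞ ≤ 2^i} ≤ (2^{i+1}+1)³` and the geometric series in `8/λ² > 1` give `M³`).  Size L. [cite: AizenmanDuminilCopinAnnals2021, eq. (5.3)] -/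
theorem stub_boxTwoPointSums :
    ∀ (c C : ℝ) (k₀ : ℕ), 0 < c →
      (∀ k : ℕ, k₀ ≤ k →
        c * arm1 (k : ℝ)⁻¹ 1 ^ 2 ≤ criticalTwoPoint 3 (Pi.single 0 (k : ℤ)) ∧
          criticalTwoPoint 3 (Pi.single 0 (k : ℤ)) ≤ C * arm1 (k : ℝ)⁻¹ 1 ^ 2) →
      ∀ (lam K₀ : ℝ), 0 < lam → lam ^ 2 < 8 → 0 < K₀ →
        (∀ K : ℝ, K₀ ≤ K → arm1 (K / 2)⁻¹ 1 ≤ lam * arm1 K⁻¹ 1) →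
        (∀ K K' : ℝ, 0 < K → K ≤ K' → arm1 K'⁻¹ 1 ≤ arm1 K⁻¹ 1) →
        (∀ K : ℝ, 1 ≤ K → 0 < arm1 K⁻¹ 1 ∧ arm1 K⁻¹ 1 ≤ 1) →
        ∃ (c' C' : ℝ) (M₀ : ℕ), 0 < c' ∧ ∀ M : ℕ, M₀ ≤ M →
          (∀ y ∈ box 3 M, c' * arm1 (M : ℝ)⁻¹ 1 ^ 2 ≤ criticalTwoPoint 3 y) ∧
          ∑ y ∈ box 3 M, criticalTwoPoint 3 y ≤ C' * (M : ℝ) ^ 3 * arm1 (M : ℝ)⁻¹ 1 ^ 2 :=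
  CrossPos.stub_boxTwoPointSums  -- LANDED

/-- **STUB S6 — two-ball positivity** (the LEAD's stub: for disjoint closed balls `A, B`, the discretisations
`A^δ, B^δ` are finite, disjoint, of size `≍ δ⁻³`; all differences lie in boxes of size `≍ δ⁻¹`; the box sums bound
`χ_{A^δ}, χ_{B^δ} ≤ C δ⁻⁶ a(δ⁻¹)²` and `Σ_{A^δ×B^δ} G ≥ c δ⁻⁶ a(δ⁻¹)²` (doubling compares the two box scales), and
the second-moment inequality, rearranged as `(ΣG)² ≤ Pr · (2(ΣG)² + χ_Aχ_B)`, gives `Pr ≥ 1/(2 + C²/c²)`).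
Size L. [cite: CamiaFeng2025, §3.2.2] -/
theorem stub_twoBallPositive :
    (∀ (X Y : Finset (Site 3)), Disjoint X Y →
      (∑ x ∈ X, ∑ y ∈ Y, criticalCorr 3 2 ![x, y]) ^ 2 ≤
        Pr 2 ![(↑X : Set (Site 3)), ↑Y] {R | R 0 1} *
          ∑ x ∈ X, ∑ y ∈ Y, ∑ x' ∈ X, ∑ y' ∈ Y,
            (criticalCorr 3 2 ![x, y] * criticalCorr 3 2 ![x', y'] +
              criticalCorr 3 2 ![x, x'] * criticalCorr 3 2 ![y, y'] +
              criticalCorr 3 2 ![x, y'] * criticalCorr 3 2 ![y, x'])) →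
    ((∃ lam K₀ : ℝ, 0 < lam ∧ lam ^ 2 < 8 ∧ 0 < K₀ ∧
          ∀ K : ℝ, K₀ ≤ K → arm1 (K / 2)⁻¹ 1 ≤ lam * arm1 K⁻¹ 1) ∧
        (∀ K K' : ℝ, 0 < K → K ≤ K' → arm1 K'⁻¹ 1 ≤ arm1 K⁻¹ 1) ∧
        (∀ K : ℝ, 1 ≤ K → 0 < arm1 K⁻¹ 1 ∧ arm1 K⁻¹ 1 ≤ 1)) →
    (∃ (c' C' : ℝ) (M₀ : ℕ), 0 < c' ∧ ∀ M : ℕ, M₀ ≤ M →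
          (∀ y ∈ box 3 M, c' * arm1 (M : ℝ)⁻¹ 1 ^ 2 ≤ criticalTwoPoint 3 y) ∧
          ∑ y ∈ box 3 M, criticalTwoPoint 3 y ≤ C' * (M : ℝ) ^ 3 * arm1 (M : ℝ)⁻¹ 1 ^ 2) →
    ∀ (a b : E3) (ra rb : ℝ), 0 < ra → 0 < rb →
      Disjoint (Metric.closedBall a ra) (Metric.closedBall b rb) →
      ∃ c : ℝ, 0 < c ∧ ∀ᶠ δ in 𝓝[>] (0:ℝ),
        c ≤ Pr 2 ![disc δ (Metric.closedBall a ra), disc δ (Metric.closedBall b rb)] {R | R 0 1} :=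
  CrossPos.stub_twoBallPositive  -- LANDED p161907

/-- **STUB S5 — FKG reduction** (two-ball positivity ⇒ `CrossLawPositive`: every generalised ball with non-zero
radius has non-empty interior, so each pair `(gball p_i, gball p_{n+i})` contains a pair of DISJOINT closed balls
`A_i ⊆ gball p_i`, `B_i ⊆ gball p_{n+i}` of positive radius; `Pr[CROSS]` decreases when the probes shrink
(`InvBook.Pr_mono_set`, discs of gballs are finite or co-finite, `InvBook.cross_upward`); at finite `L` the CROSS
event of the shrunken family is the intersection of the `n` increasing events `{A_i^δ ↔ B_i^δ}` so FKG
(`rcMeasure_fkg_holds`, induction on `n`) bounds it below by the product; `L → ∞` (`InvBook.tendsto_PrL`) and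
`Filter.eventually_all` finish with `c = ∏ c_i`).  Size L. [cite: Grimmett2006, Thm. 3.8] -/
theorem stub_fkgReduction :
    (∀ (a b : E3) (ra rb : ℝ), 0 < ra → 0 < rb →
        Disjoint (Metric.closedBall a ra) (Metric.closedBall b rb) →
        ∃ c : ℝ, 0 < c ∧ ∀ᶠ δ in 𝓝[>] (0:ℝ),
          c ≤ Pr 2 ![disc δ (Metric.closedBall a ra), disc δ (Metric.closedBall b rb)] {R | R 0 1}) →
      CrossLawPositive :=
  CrossPos.stub_fkgReduction  -- LANDED

/-! ## Name-keyed aliases of the stub statements (the hypotheses of the composition) -/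
namespace Registered

/-- Alias keyed by the registered stub name. [folklore] -/
abbrev stub_secondMoment : Prop :=
  ∀ (X Y : Finset (Site 3)), Disjoint X Y →
    (∑ x ∈ X, ∑ y ∈ Y, criticalCorr 3 2 ![x, y]) ^ 2 ≤
      Pr 2 ![(↑X : Set (Site 3)), ↑Y] {R | R 0 1} *
        ∑ x ∈ X, ∑ y ∈ Y, ∑ x' ∈ X, ∑ y' ∈ Y,
          (criticalCorr 3 2 ![x, y] * criticalCorr 3 2 ![x', y'] +
            criticalCorr 3 2 ![x, x'] * criticalCorr 3 2 ![y, y'] +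
            criticalCorr 3 2 ![x, y'] * criticalCorr 3 2 ![y, x'])

/-- Alias keyed by the registered stub name. [folklore] -/
abbrev stub_axisTwoPoint : Prop :=
  ArmDressing.EvenPatternDecoupling → ArmDressing.ArmExtensionFactorisation →
    ∃ (c C : ℝ) (k₀ : ℕ), 0 < c ∧ ∀ k : ℕ, k₀ ≤ k →
      c * arm1 (k : ℝ)⁻¹ 1 ^ 2 ≤ criticalTwoPoint 3 (Pi.single 0 (k : ℤ)) ∧
        criticalTwoPoint 3 (Pi.single 0 (k : ℤ)) ≤ C * arm1 (k : ℝ)⁻¹ 1 ^ 2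

/-- Alias keyed by the registered stub name. [folklore] -/
abbrev stub_armDoubling : Prop :=
  ArmDressing.EvenPatternDecoupling → ArmDressing.ArmExtensionFactorisation →
    (∃ lam K₀ : ℝ, 0 < lam ∧ lam ^ 2 < 8 ∧ 0 < K₀ ∧
        ∀ K : ℝ, K₀ ≤ K → arm1 (K / 2)⁻¹ 1 ≤ lam * arm1 K⁻¹ 1) ∧
      (∀ K K' : ℝ, 0 < K → K ≤ K' → arm1 K'⁻¹ 1 ≤ arm1 K⁻¹ 1) ∧
      (∀ K : ℝ, 1 ≤ K → 0 < arm1 K⁻¹ 1 ∧ arm1 K⁻¹ 1 ≤ 1)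

/-- Alias keyed by the registered stub name. [folklore] -/
abbrev stub_boxTwoPointSums : Prop :=
  ∀ (c C : ℝ) (k₀ : ℕ), 0 < c →
    (∀ k : ℕ, k₀ ≤ k →
      c * arm1 (k : ℝ)⁻¹ 1 ^ 2 ≤ criticalTwoPoint 3 (Pi.single 0 (k : ℤ)) ∧
        criticalTwoPoint 3 (Pi.single 0 (k : ℤ)) ≤ C * arm1 (k : ℝ)⁻¹ 1 ^ 2) →
    ∀ (lam K₀ : ℝ), 0 < lam → lam ^ 2 < 8 → 0 < K₀ →
      (∀ K : ℝ, K₀ ≤ K → arm1 (K / 2)⁻¹ 1 ≤ lam * arm1 K⁻¹ 1) →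
      (∀ K K' : ℝ, 0 < K → K ≤ K' → arm1 K'⁻¹ 1 ≤ arm1 K⁻¹ 1) →
      (∀ K : ℝ, 1 ≤ K → 0 < arm1 K⁻¹ 1 ∧ arm1 K⁻¹ 1 ≤ 1) →
      ∃ (c' C' : ℝ) (M₀ : ℕ), 0 < c' ∧ ∀ M : ℕ, M₀ ≤ M →
        (∀ y ∈ box 3 M, c' * arm1 (M : ℝ)⁻¹ 1 ^ 2 ≤ criticalTwoPoint 3 y) ∧
        ∑ y ∈ box 3 M, criticalTwoPoint 3 y ≤ C' * (M : ℝ) ^ 3 * arm1 (M : ℝ)⁻¹ 1 ^ 2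

/-- Alias keyed by the registered stub name. [folklore] -/
abbrev stub_twoBallPositive : Prop :=
  (∀ (X Y : Finset (Site 3)), Disjoint X Y →
    (∑ x ∈ X, ∑ y ∈ Y, criticalCorr 3 2 ![x, y]) ^ 2 ≤
      Pr 2 ![(↑X : Set (Site 3)), ↑Y] {R | R 0 1} *
        ∑ x ∈ X, ∑ y ∈ Y, ∑ x' ∈ X, ∑ y' ∈ Y,
          (criticalCorr 3 2 ![x, y] * criticalCorr 3 2 ![x', y'] +
            criticalCorr 3 2 ![x, x'] * criticalCorr 3 2 ![y, y'] +
            criticalCorr 3 2 ![x, y'] * criticalCorr 3 2 ![y, x'])) →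
  ((∃ lam K₀ : ℝ, 0 < lam ∧ lam ^ 2 < 8 ∧ 0 < K₀ ∧
        ∀ K : ℝ, K₀ ≤ K → arm1 (K / 2)⁻¹ 1 ≤ lam * arm1 K⁻¹ 1) ∧
      (∀ K K' : ℝ, 0 < K → K ≤ K' → arm1 K'⁻¹ 1 ≤ arm1 K⁻¹ 1) ∧
      (∀ K : ℝ, 1 ≤ K → 0 < arm1 K⁻¹ 1 ∧ arm1 K⁻¹ 1 ≤ 1)) →
  (∃ (c' C' : ℝ) (M₀ : ℕ), 0 < c' ∧ ∀ M : ℕ, M₀ ≤ M →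
        (∀ y ∈ box 3 M, c' * arm1 (M : ℝ)⁻¹ 1 ^ 2 ≤ criticalTwoPoint 3 y) ∧
        ∑ y ∈ box 3 M, criticalTwoPoint 3 y ≤ C' * (M : ℝ) ^ 3 * arm1 (M : ℝ)⁻¹ 1 ^ 2) →
  ∀ (a b : E3) (ra rb : ℝ), 0 < ra → 0 < rb →
    Disjoint (Metric.closedBall a ra) (Metric.closedBall b rb) →
    ∃ c : ℝ, 0 < c ∧ ∀ᶠ δ in 𝓝[>] (0:ℝ),
      c ≤ Pr 2 ![disc δ (Metric.closedBall a ra), disc δ (Metric.closedBall b rb)] {R | R 0 1}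

/-- Alias keyed by the registered stub name. [folklore] -/
abbrev stub_fkgReduction : Prop :=
  (∀ (a b : E3) (ra rb : ℝ), 0 < ra → 0 < rb →
      Disjoint (Metric.closedBall a ra) (Metric.closedBall b rb) →
      ∃ c : ℝ, 0 < c ∧ ∀ᶠ δ in 𝓝[>] (0:ℝ),
        c ≤ Pr 2 ![disc δ (Metric.closedBall a ra), disc δ (Metric.closedBall b rb)] {R | R 0 1}) →
    CrossLawPositive

end Registered

/-- The stubs prove their registered aliases (sanity: the aliases are syntactically the stub statements). [folklore] -/
theorem registered_of_stubs :
    Registered.stub_secondMoment ∧ Registered.stub_axisTwoPoint ∧ Registered.stub_armDoubling ∧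
      Registered.stub_boxTwoPointSums ∧ Registered.stub_twoBallPositive ∧ Registered.stub_fkgReduction :=
  ⟨stub_secondMoment, stub_axisTwoPoint, stub_armDoubling, stub_boxTwoPointSums, stub_twoBallPositive,
    stub_fkgReduction⟩

/-! ## The composition: the crux, by name (real proof, no `sorry`, no hypothesis) -/

/-- `CrossLawPositive` from cruxes B and C through the six LANDED stubs. [cite: CamiaFeng2025, §3.2.2] -/
theorem crossLawPositive_of (hB : ArmDressing.EvenPatternDecoupling) (hC : ArmDressing.ArmExtensionFactorisation) :
    CrossLawPositive := by
  obtain ⟨c, C, k₀, hc, hax⟩ := CrossPos.stub_axisTwoPoint hB hC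
  obtain ⟨⟨lam, K₀, hlam, hlam8, hK₀, hdbl⟩, hanti, hpos⟩ := CrossPos.stub_armDoubling hB hC
  exact CrossPos.stub_fkgReduction (CrossPos.stub_twoBallPositive CrossPos.stub_secondMoment
    ⟨⟨lam, K₀, hlam, hlam8, hK₀, hdbl⟩, hanti, hpos⟩
    (CrossPos.stub_boxTwoPointSums c C k₀ hc hax lam K₀ hlam hlam8 hK₀ hdbl hanti hpos))

/-- **THE SKELETON THEOREM (v3.2, final)** — `ArmDressing.ArmDressingGlue` outright: cruxes B and C give
`CrossLawPositive` (`crossLawPositive_of`), and the landed composition `InvBook.armDressingGlue_of_crossLawPositive`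
(p156871) does the rest; the same proof is the tree theorem `Theorems.armDressing_armDressingGlue_proof` (p162524)
that closed the item. [cite: CamiaFeng2025, §3.2.2–3.2.3] -/
theorem ArmDressingGlue_of : ArmDressing.ArmDressingGlue :=
  fun hA hB hC => InvBook.armDressingGlue_of_crossLawPositive (crossLawPositive_of hB hC) hA hB hC

/-- The tree's closing theorem and the skeleton theorem agree (both prove the crux by name). [folklore] -/
example : ArmDressing.ArmDressingGlue := Theorems.armDressing_armDressingGlue_proof

end Summit.CriticalPhenomena.Ising3DConformalLimit.Cruxes.ArmDressingGlue.Birth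

end
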